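import Summits.ValiantsHypothesis.ValiantsHypothesis.Theorems.BarrierLeverPartitionMinorsChowTropicalDegrees

/-!
# Route BarrierLever — Chow witnesses for partition minors (item 20172, CPM): TROPICAL (Newton-face)
# CERTIFICATES — a weight table whose leading Leibniz terms do not cancel gives a Chow witness

Helper file (`--supports stmt-ValiantsHypothesis-20172`; cell valiant-natproofs, rung V4, 𝒟-side of
door (c); seat val-np-p4 gen 11).  Closes NO item.  Conventions of items 19717 / 20172 / 20195: the
layout `(u, w)` (`u w : Fin r → Finset (Fin h)`) is HIT when some product of `h + h` affine forms has
`det [coeff (E (u i) (w j)) (∏ q, ℓ q)] ≠ 0`.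

**The certificate.**  Take the one-parameter family of forms `ℓ_k = 1 + Σ_a t^{ωx k a} x_a +
Σ_c t^{ωy k c} y_c` (`k < h + h`, weights `ωx ωy : ℕ → Fin h → ℕ`, `t` an indeterminate).  The
partition coefficient `ψ_m(u,w) = coeff (E u w) (∏_{k<m} ℓ_k) ∈ ℂ[t]` has nonnegative integer
coefficients; its degree `tropDeg m u w` (the MAX-PLUS value of assigning the variables of `u ⊔ w`
injectively to forms) and its leading coefficient `tropLC m u w > 0` (the number of optimal
assignments) obey the max-plus / counting shadow of the recursion `coeff_partitionExpo_mul_affine`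
(`tropDeg`, `tropLC`, `psi_invariant` of part 1, `…ChowTropicalDegrees`).  Hence, in the Leibniz
expansion of the partition minor, the coefficient of `t^M`, `M` = the optimal value of the OUTER
assignment `σ ↦ Σ_j tropDeg (u (σ j)) (w j)`, is the signed count
`Z = Σ_{σ optimal} sign σ · ∏_j tropLC (u (σ j)) (w j)` (`coeff_det_eq_sum_of_natDegree_le`, part 1), and:

* `chow_hit_of_tropicalCert` — **if `Z ≠ 0` (in particular if the optimal `σ` is unique,
  `chow_hit_of_unique_tropicalOpt`) then `(u, w)` is hit** (specialise `t` to a non-root).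

This is the CPM analogue of the tree's `TropicalDet.tropicalDetCertificateSuffices` (item 19315, for
the refuted transversal witnesses); here the witness family is the conjecturally complete one.  Seat
census (kit j272975 / j274814, evidence on item 20172): with 0/1 weights the signed certificate exists
for ALL 12 869 layout pairs of height 3 and for all 2 000 sampled locked pairs of height 4; curve
(lexicographic) weights `ω(k, v) = e_v · B^{2h-1-k}` — the leading-term certificates of planner
valiant-natproofs-p1 g15's MEMO-normalforms §6 — give a UNIQUE optimum for 11 959 / 12 869 (h = 3) and
1 470 / 2 000 (h = 4, locked).

WHAT THIS IS NOT: a door — the certificate must be supplied (per layout or per class of layouts, by a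
combinatorial argument); nothing on items 20172 / 20195 / 19717 themselves, on crux
stmt-ValiantsHypothesis-14610, or on `VP` versus `VNP`.
-/

set_option linter.dupNamespace false

namespace Summit.ValiantsHypothesis.ValiantsHypothesis.Theorems.BarrierLever.ChowFactor

open Finset MvPolynomial

noncomputable section

variable {h : ℕ}

/-! ## 3. The certificate gives a hit -/

/-- A nonzero complex polynomial has a non-root. -/
theorem exists_eval_ne_zero_of_poly_ne_zero {f : Polynomial ℂ} (hf : f ≠ 0) : ∃ z : ℂ, f.eval z ≠ 0 := by
  by_contra hcon
  push Not at hcon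
  apply hf
  refine Polynomial.eq_zero_of_infinite_isRoot f ?_
  have hall : {x : ℂ | f.IsRoot x} = Set.univ := Set.eq_univ_of_forall fun x => hcon x
  rw [hall]
  exact Set.infinite_univ

/-- An affine combination `C c₀ + Σ_a C α_a · x_a + Σ_c C β_c · y_c` has total degree `≤ 1`. -/
theorem totalDegree_affineXY_le {R : Type*} [CommSemiring R] (c₀ : R) (α β : Fin h → R) :
    (C c₀ + ∑ a, C (α a) * X (Fin.castAdd h a) + ∑ c, C (β c) * X (Fin.natAdd h c) :
      MvPolynomial (Fin (h + h)) R).totalDegree ≤ 1 := by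
  have hterm : ∀ (x : R) (v : Fin (h + h)), (C x * X v : MvPolynomial (Fin (h + h)) R).totalDegree ≤ 1 :=
    fun x v => by
      refine (totalDegree_mul _ _).trans ?_
      rw [totalDegree_C, zero_add]
      refine (totalDegree_monomial_le _ _).trans ?_
      rw [Finsupp.sum_single_index rfl]
      exact le_rfl
  refine (totalDegree_add _ _).trans (max_le ((totalDegree_add _ _).trans (max_le ?_ ?_)) ?_)
  · rw [totalDegree_C]
    exact Nat.zero_le _
  · exact (totalDegree_finsetSum _ _).trans (Finset.sup_le fun a _ => hterm _ _)
  · exact (totalDegree_finsetSum _ _).trans (Finset.sup_le fun c _ => hterm _ _)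

/-- The one-parameter form specialised at `t`. -/
theorem map_tropForm (ωx ωy : ℕ → Fin h → ℕ) (t : ℂ) (k : ℕ) :
    MvPolynomial.map (Polynomial.evalRingHom t) (tropForm ωx ωy k) =
      C 1 + ∑ a, C (t ^ ωx k a) * X (Fin.castAdd h a) + ∑ c, C (t ^ ωy k c) * X (Fin.natAdd h c) := by
  unfold tropForm
  simp only [map_add, map_sum, map_mul, map_C, map_X, map_one, map_pow, Polynomial.coe_evalRingHom,
    Polynomial.eval_X]

/-- **TROPICAL CERTIFICATE ⇒ HIT.**  Let `M` bound the value `Σ_j tropDeg (u (σ j)) (w j)` of every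
assignment `σ` of rows to columns.  If the signed count of optimal assignments (weighted by the products
of the numbers `tropLC` of optimal inner assignments) is nonzero, then `(u, w)` is hit by a product of
`h + h` affine forms (namely the one-parameter forms specialised at a suitable complex `t`). -/
theorem chow_hit_of_tropicalCert {r : ℕ} (u w : Fin r → Finset (Fin h)) (ωx ωy : ℕ → Fin h → ℕ)
    (M : ℕ) (hM : ∀ σ : Equiv.Perm (Fin r), ∑ j, tropDeg ωx ωy (h + h) (u (σ j)) (w j) ≤ M)
    (hZ : (∑ σ : Equiv.Perm (Fin r),
      if ∑ j, tropDeg ωx ωy (h + h) (u (σ j)) (w j) = M then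
        (Equiv.Perm.sign σ : ℤ) * ∏ j, (tropLC ωx ωy (h + h) (u (σ j)) (w j) : ℤ) else 0) ≠ 0) :
    ∃ ℓ : Fin (h + h) → MvPolynomial (Fin (h + h)) ℂ, (∀ q, (ℓ q).totalDegree ≤ 1) ∧
      (Matrix.of fun i j : Fin r => coeff
        (∑ b ∈ u i, Finsupp.single (Fin.castAdd h b) 1 + ∑ d ∈ w j, Finsupp.single (Fin.natAdd h d) 1)
        (∏ q, ℓ q)).det ≠ 0 := by
  classical
  set P : Matrix (Fin r) (Fin r) (Polynomial ℂ) :=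
    Matrix.of fun i j => psi ωx ωy (h + h) (u i) (w j) with hP
  have hfe : ∀ i j : Fin r, (u i).card + (w j).card ≤ h + h := fun i j =>
    Nat.add_le_add ((Finset.card_le_univ _).trans (by rw [Fintype.card_fin]))
      ((Finset.card_le_univ _).trans (by rw [Fintype.card_fin]))
  have hcoeff : (Matrix.det P).coeff M = ((∑ σ : Equiv.Perm (Fin r),
      if ∑ j, tropDeg ωx ωy (h + h) (u (σ j)) (w j) = M then
        (Equiv.Perm.sign σ : ℤ) * ∏ j, (tropLC ωx ωy (h + h) (u (σ j)) (w j) : ℤ) else 0 : ℤ) : ℂ) := by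
    rw [coeff_det_eq_sum_of_natDegree_le P (fun i j => tropDeg ωx ωy (h + h) (u i) (w j))
      (fun i j => (psi_invariant ωx ωy (h + h) (u i) (w j) (hfe i j)).1) M hM]
    push_cast
    refine Finset.sum_congr rfl fun σ _ => ?_
    split_ifs with hσ
    · congr 1
      refine Finset.prod_congr rfl fun j _ => ?_
      rw [hP, Matrix.of_apply]
      exact (psi_invariant ωx ωy (h + h) (u (σ j)) (w j) (hfe _ _)).2.1
    · rfl
  have hdet : Matrix.det P ≠ 0 := by
    intro h0
    rw [h0, Polynomial.coeff_zero] at hcoeff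
    exact hZ (by exact_mod_cast hcoeff.symm)
  obtain ⟨t, ht⟩ := exists_eval_ne_zero_of_poly_ne_zero hdet
  refine ⟨fun q => MvPolynomial.map (Polynomial.evalRingHom t) (tropForm ωx ωy (q : ℕ)), fun q => ?_, ?_⟩
  · show (MvPolynomial.map (Polynomial.evalRingHom t) (tropForm ωx ωy (q : ℕ))).totalDegree ≤ 1
    rw [map_tropForm]
    exact totalDegree_affineXY_le _ _ _
  · have hprod : (∏ q : Fin (h + h), MvPolynomial.map (Polynomial.evalRingHom t) (tropForm ωx ωy (q : ℕ))) =
        MvPolynomial.map (Polynomial.evalRingHom t) (∏ k ∈ Finset.range (h + h), tropForm ωx ωy k) := by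
      rw [← map_prod, Fin.prod_univ_eq_prod_range (fun k => tropForm ωx ωy k) (h + h)]
    have hmat : (Matrix.of fun i j : Fin r => coeff
        (∑ b ∈ u i, Finsupp.single (Fin.castAdd h b) 1 + ∑ d ∈ w j, Finsupp.single (Fin.natAdd h d) 1)
        (∏ q : Fin (h + h), MvPolynomial.map (Polynomial.evalRingHom t) (tropForm ωx ωy (q : ℕ)))) =
        (Polynomial.evalRingHom t).mapMatrix P := by
      ext i j
      rw [Matrix.of_apply, hprod, MvPolynomial.coeff_map, RingHom.mapMatrix_apply, Matrix.map_apply,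
        hP, Matrix.of_apply]
      rfl
    rw [hmat, ← RingHom.map_det]
    exact ht

/-- **UNIQUE OPTIMUM ⇒ HIT**: if one assignment `σ₀` of rows to columns has strictly larger value
`Σ_j tropDeg (u (σ j)) (w j)` than every other, then `(u, w)` is hit. -/
theorem chow_hit_of_unique_tropicalOpt {r : ℕ} (u w : Fin r → Finset (Fin h))
    (ωx ωy : ℕ → Fin h → ℕ) (σ₀ : Equiv.Perm (Fin r))
    (huniq : ∀ σ : Equiv.Perm (Fin r), σ ≠ σ₀ →
      ∑ j, tropDeg ωx ωy (h + h) (u (σ j)) (w j) < ∑ j, tropDeg ωx ωy (h + h) (u (σ₀ j)) (w j)) :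
    ∃ ℓ : Fin (h + h) → MvPolynomial (Fin (h + h)) ℂ, (∀ q, (ℓ q).totalDegree ≤ 1) ∧
      (Matrix.of fun i j : Fin r => coeff
        (∑ b ∈ u i, Finsupp.single (Fin.castAdd h b) 1 + ∑ d ∈ w j, Finsupp.single (Fin.natAdd h d) 1)
        (∏ q, ℓ q)).det ≠ 0 := by
  classical
  have hfe : ∀ i j : Fin r, (u i).card + (w j).card ≤ h + h := fun i j =>
    Nat.add_le_add ((Finset.card_le_univ _).trans (by rw [Fintype.card_fin]))
      ((Finset.card_le_univ _).trans (by rw [Fintype.card_fin]))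
  refine chow_hit_of_tropicalCert u w ωx ωy (∑ j, tropDeg ωx ωy (h + h) (u (σ₀ j)) (w j))
    (fun σ => ?_) ?_
  · by_cases hσ : σ = σ₀
    · rw [hσ]
    · exact (huniq σ hσ).le
  · rw [Finset.sum_eq_single σ₀ (fun σ _ hσ => by rw [if_neg (huniq σ hσ).ne]) (fun hσ => absurd (Finset.mem_univ σ₀) hσ),
      if_pos rfl]
    refine mul_ne_zero ?_ (Finset.prod_ne_zero_iff.mpr fun j _ => ?_)
    · rcases Int.units_eq_one_or (Equiv.Perm.sign σ₀) with h1 | h1 <;> rw [h1] <;> decide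
    · exact_mod_cast (psi_invariant ωx ωy (h + h) (u (σ₀ j)) (w j) (hfe _ _)).2.2.ne'

end

end Summit.ValiantsHypothesis.ValiantsHypothesis.Theorems.BarrierLever.ChowFactor
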